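import Summits.BirchSwinnertonDyer.BirchSwinnertonDyer.Theses.PrintCf2RubinValueTwo
import Summits.BirchSwinnertonDyer.BirchSwinnertonDyer.Theorems.PrintCf2RubinValueTwoTwistedIwasawaDataExist
import HarnessLib

/-!
# Route C `PrintCf2RubinValueTwo`, item F0b `TwistedIwasawaDataExistsOfPrints` (stmt-BirchSwinnertonDyer-23317): CLOSED BY NAME

Cell `bsd-print-cf2`, WIDTH seat `bsd-line-cf2-p1-w5` g10 (prover-bsd-line-cf2-p1-w5-g10-0). The route's aside item F0b (planner g21, route C rev 26)
— «modulo the prints (E) Kato 2004 §15.5, (O1) de Shalit II.2.4 (i)/II.2.5 (i), (O2) de Shalit II.2.4 (ii), for every imaginary quadratic `K`, prime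
`p`, `ℤ_p`-extensions `κ₁ κ₂` with a topological generator pair `(γ₁, γ₂)` up to unit twists, `θ` trivial on `Gal(K̄/K(𝔣))` (`𝔣 ≠ 0`), `ι`, and ANY
three pinned carriers `I0 I1 I2`, ty2's `JohnsonLeungKings2011.TwistedIwasawaData` EXISTS with these carriers» — is the theorem
`TwistedZeta.exists_twistedIwasawaData` of `…Theorems.PrintCf2RubinValueTwoTwistedIwasawaDataExist` (p730057; files 1–5 of the F0b lane p728432,
p729312, p729584, p729633, p730057). HONEST FRAMING: a CONSTRUCTION item (the existence of the pinned datum), conditional on four PUBLISHED named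
facts carried as antecedents inside the item's own statement; it does not prove [JLK] Cor. 5.3 (`cor53_thm52Shape` remains a named fact), it is not
a partition leaf, no summit statement is proved by this seat, and BSD is not proved by any of this.
-/

noncomputable section

-- the summit namespace `Summit.BirchSwinnertonDyer.BirchSwinnertonDyer` repeats the problem name by design (D-0017)
set_option linter.dupNamespace false
set_option autoImplicit false

namespace Summit.BirchSwinnertonDyer.BirchSwinnertonDyer.Theorems

/-- **F0b CLOSED BY NAME**: the route decl `Theses.PrintCf2RubinValueTwo.TwistedIwasawaDataExistsOfPrints` (stmt-BirchSwinnertonDyer-23317), by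
`TwistedZeta.exists_twistedIwasawaData`. [cite: JohnsonLeungKings2011, Def. 3.2, Prop. 3.3, Def. 3.5, §4.2 Def. 4.2 (94), §5.1–5.2 (arXiv p0009:L55–95, p0010:L55–80, p0012:L80–112, p0014:L12–112)] [cite: Kato2004Asterisque, §15.5 (p. 253), §15.6 (p. 254)] [cite: deShalit1987, II.2.4 Proposition, II.2.5 Proposition] -/
theorem twistedIwasawaDataExistsOfPrints_proof : Theses.PrintCf2RubinValueTwo.TwistedIwasawaDataExistsOfPrints := by
  unfold Theses.PrintCf2RubinValueTwo.TwistedIwasawaDataExistsOfPrints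
  intro hE h24i h24ii h25 K _ _ p _ κ₁ κ₂ γ₁ γ₂ θ 𝔣 ι hK hγ h𝔣 hθ𝔣 I0 I1 I2
  exact PrintCf2.TwistedZeta.exists_twistedIwasawaData p θ 𝔣 hE h24i h24ii h25 hK ι hγ h𝔣 hθ𝔣 I0 I1 I2

end Summit.BirchSwinnertonDyer.BirchSwinnertonDyer.Theorems

end
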